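import Summits.SmoothPoincare4.SmoothPoincare4.Theses.CongruenceShadows
import Summits.SmoothPoincare4.SmoothPoincare4.Theorems.ShadowsStandard.Negative.ShadowLevels
import Summits.SmoothPoincare4.SmoothPoincare4.Theorems.CongruenceShadowsShadowsStandardStubFaceNormalFormGenusThree
import HarnessLib
import HarnessLib.Audit

/-!
# Line `finitary-ac-central-residue` for crux `CongruenceShadows.ShadowsStandard` (stmt-SmoothPoincare4-14593)

Skeleton (crux-plan, round 1; idea `finitary-ac-central-residue`, ideator 2; triage r1-1/2/3: pass ×3,
sharpenings answered in `Lines/finitary-ac-central-residue.md`).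

**Thesis of the line.** Seen from inside the first handlebody and modulo a characteristic level,
everything a trisection of `{1}` shows is standard by Borovik–Lubotzky–Myasnikov's FINITARY
Andrews–Curtis theorem; what survives is ONE double intersection `N₀M ∩ K₂M`, and a two-level
RESIDUE LEMMA (proved here) turns Goeritz-rigidity of that intersection into the crux, the loss of
one level being paid for by the (effective) centrelessness of normal subgroups of free profinite
groups (Melnikov).  No profinite object, no compactness and no coherent family appears in the
composition: the card's `IntersectionRigidity^coh` is replaced by its LEVEL-WISE form (Stub 3) plus
an effective two-level centre-killing statement (Stub 4).

Notation (existing declarations only): `S = SurfaceGroup (3+3m)`, `N = s4Kernels.stabilizeIter m`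
(standard balanced triple of `S⁴`, `k = m+1`), `F = S ⧸ N 0` (`= π₁(H₀) ≅ F_{3k}`),
`π = QuotientGroup.mk' (N 0)`, `R₁ = π(N 1)` (normal closure of the `2k` "tails"), levels
`M' ≤ M` characteristic of finite index in `S`.

Chain after the lead's RESHAPE (seat c1, 2026-08-16; same composition idea, 6 registered stubs; all glue
between them is PROVED in this file):

  crux data `m, K, hK, M` and the route item `WaldhausenPairs` (hypothesis `hW`, item 14592)
  —[proved: slot normalisation by `hW m K hK 0 1` + `Aut S`-transport (`isGroupTrisection_map`, `undo`)]→
     WLOG `K 0 = N 0`, `K 1 = N 1`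
  —[effective centrelessness ×2 (pairs `(N 0, N 2)` and `(N 0, K 2)`): registered stubs §7a/§7b
     `stub_effectiveCentrelessStd/Trisection`, PROVED in Theorems/…EffectiveCentreless.lean from the four
     LANDED stubs `stub_centralizerFreeKernel` (K-free Magnus-quotient core), `stub_stdPairPrimitives`,
     `stub_trisectionPairPrimitives_zero/_succ` (two primitives in the kernel); deeper level `M' = M ⊓ M_Q`]→ `M'`
  —[one-sided normal form at level `M'`: genus 3 = tree theorem `stub_faceNormalFormGenusThree`
     (exact); genus ≥ 6 = §1 `stub_oneSidedNormalForm_succ` (plan Stubs 1+2 merged, level form)]→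
     `χ ∈ Stab(N 0) ∩ Stab(N 1)`, `χ(N 2 ⊔ N 0 ⊔ M') = K 2 ⊔ N 0 ⊔ M'`; replace `K` by `K' = χ⁻¹ • K`
  —[§6 `stub_intersectionRigidity` (the RESIDUE CRUX C⁺, load-bearing, lead): `φ ∈ St₀ ∩ St₁` fixing
     `N 2 ⊔ N 0 ⊔ M'` with `φ(N₀M' ∩ N₂M') = N₀M' ∩ K'₂M'`]→ `φ`
  —[§8 `stub_exactShadowReduction` (pure glue, PROVED in Theorems/…ResidueReduction.lean: two-level residue
     lemma in both directions fed by effective centrelessness transported along `φ` and `χ⁻¹`,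
     `ψ := χ ∘ φ`)]→ exact Goeritz `ψ` with `ψ(N i ⊔ M) = K' i ⊔ M`
  —[proved: undo the Waldhausen `α`]→ the crux at level `M`.

Plan ↔ reshape: plan Stub 1 (`stub_finitaryAC`) + Stub 2 (`stub_goeritzRealisation`) ↦ §1 (merged,
weaker, genus ≥ 6 only; genus 3 is in the tree); plan Stub 3 ↦ §6 verbatim; plan Stub 4
(`stub_effectiveCentreless`, Melnikov + compactness) ↦ §2 + §3 + §4 + §5 with an elementary proof
route (Magnus quotient `(ι → P → 𝔽₃) ⋊ P`), restricted to the two pairs the composition uses.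

-/

noncomputable section

set_option linter.dupNamespace false
set_option linter.unusedVariables false

open Literature.Topology.FourManifolds
open Subgroup

namespace Summit.SmoothPoincare4.SmoothPoincare4.Cruxes.ShadowsStandard.FinitaryAcCentralResidue

open _root_.Summit.SmoothPoincare4.SmoothPoincare4.Theorems.ShadowsStandard.Negative
  (levelSubgroup levelSubgroup_quotient_le levelSubgroup_finiteIndex levelSubgroup_characteristic)
open _root_.Summit.SmoothPoincare4.SmoothPoincare4.Theorems.ShadowsStandard.PowerTwistAbsorption
  (stub_faceNormalFormGenusThree)

/-! ## 0. Conventions and sorry-free transport lemmas -/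

/-- The standard kernels `s4Kernels.stabilizeIter m i` are normal closures, hence normal; this
instance makes `SurfaceGroup (3+3m) ⧸ s4Kernels.stabilizeIter m 0` a group (`= π₁(H₀)`). -/
instance stdKernel_normal (m : ℕ) (i : Fin 3) : (s4Kernels.stabilizeIter m i).Normal := by
  cases m with
  | zero =>
    show (s4Kernels i).Normal
    rw [s4Kernels_eq]
    infer_instance
  | succ n =>
    show ((s4Kernels.stabilizeIter n).stabilize i).Normal
    rw [TrisectionKernels.stabilize_apply]
    infer_instance

section transport

variable {G : Type*} [Group G]

/-- `H ↦ H.map` along a composite of automorphisms. -/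
theorem map_trans (e₁ e₂ : G ≃* G) (H : Subgroup G) :
    H.map (e₁.trans e₂).toMonoidHom = (H.map e₁.toMonoidHom).map e₂.toMonoidHom := by
  rw [Subgroup.map_map]
  rfl

/-- `e⁻¹` undoes `e` on subgroups. -/
theorem map_map_symm (e : G ≃* G) (H : Subgroup G) :
    (H.map e.toMonoidHom).map e.symm.toMonoidHom = H := by
  ext x
  simp

/-- `e` undoes `e⁻¹` on subgroups. -/
theorem map_symm_map (e : G ≃* G) (H : Subgroup G) :
    (H.map e.symm.toMonoidHom).map e.toMonoidHom = H := by
  ext x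
  simp

/-- If `e(H) = K` then `e⁻¹(K) = H`. -/
theorem map_symm_of_map (e : G ≃* G) {H K : Subgroup G} (h : H.map e.toMonoidHom = K) :
    K.map e.symm.toMonoidHom = H := by
  rw [← h, map_map_symm]

/-- A characteristic subgroup is fixed by every automorphism (as `map`). -/
theorem map_char (e : G ≃* G) {M : Subgroup G} (hM : M.Characteristic) :
    M.map e.toMonoidHom = M :=
  (Subgroup.characteristic_iff_map_eq.mp hM) e

end transport

variable {g : ℕ}

/-- **`Aut S_g`-invariance of the group-trisection property**: if `K` is a `(g,k)` group
trisection of `G`, so is `α • K = (α(K₀), α(K₁), α(K₂))` for every automorphism `α` of `S_g`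
(each of the seven quotients is transported by `QuotientGroup.congr`). -/
theorem isGroupTrisection_map {k : ℕ} {G : Type*} [Group G] {K : TrisectionKernels g}
    (hK : IsGroupTrisection g k G K) (α : SurfaceGroup g ≃* SurfaceGroup g) :
    IsGroupTrisection g k G (fun i => (K i).map α.toMonoidHom) := by
  have hsurj : Function.Surjective (α : SurfaceGroup g →* SurfaceGroup g) := α.surjective
  have himg : ∀ i, ((K i).map α.toMonoidHom : Set (SurfaceGroup g)) = α '' (K i) := fun i =>
    Subgroup.coe_map _ _
  have hnc : ∀ s : Set (SurfaceGroup g),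
      (Subgroup.normalClosure s).map (α : SurfaceGroup g →* SurfaceGroup g) =
        Subgroup.normalClosure (α '' s) := fun s =>
    Subgroup.map_normalClosure s _ hsurj
  refine ⟨fun i => (hK.normal i).map α.toMonoidHom α.surjective, fun i => ?_, fun i j hij => ?_, ?_⟩
  · refine (hK.free_quotient i).of_mulEquiv (QuotientGroup.congr _ _ α ?_)
    simp only [hnc, himg]
  · refine (hK.free_pairQuotient i j hij).of_mulEquiv (QuotientGroup.congr _ _ α ?_)
    simp only [hnc, himg, Set.image_union]
  · obtain ⟨e⟩ := hK.triple
    refine ⟨(QuotientGroup.congr _ _ α ?_).symm.trans e⟩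
    simp only [hnc, himg, Set.image_iUnion]

variable {m : ℕ}

/-- **Undoing a transport on the conclusion.** Standard shadows for `γ⁻¹ • K` at level `M` give
standard shadows for `K` at level `M` (`M` characteristic). -/
theorem undo (γ : SurfaceGroup (3 + 3 * m) ≃* SurfaceGroup (3 + 3 * m))
    {K : TrisectionKernels (3 + 3 * m)} {M : Subgroup (SurfaceGroup (3 + 3 * m))}
    (hM : M.Characteristic)
    (h : ∃ ψ : SurfaceGroup (3 + 3 * m) ≃* SurfaceGroup (3 + 3 * m), ∀ i : Fin 3,
      (s4Kernels.stabilizeIter m i ⊔ M).map ψ.toMonoidHom = (K i).map γ.symm.toMonoidHom ⊔ M) :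
    ∃ ψ : SurfaceGroup (3 + 3 * m) ≃* SurfaceGroup (3 + 3 * m), ∀ i : Fin 3,
      (s4Kernels.stabilizeIter m i ⊔ M).map ψ.toMonoidHom = K i ⊔ M := by
  obtain ⟨ψ, hψ⟩ := h
  refine ⟨ψ.trans γ, fun i => ?_⟩
  rw [map_trans, hψ i, Subgroup.map_sup, map_symm_map, map_char γ hM]

/-! ## 1. ONE-SIDED NORMAL FORM in `S ⧸ N 0` (Stubs 1+2 of the plan, MERGED; genus `≥ 6` only)

Stub · `stub_oneSidedNormalForm_succ` · for a slot-normalised `(3+3(n+1); n+2)` group trisection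
`(N 0, N 1, K 2)` of `{1}` and a characteristic finite-index level `M ≤ S`, some EXACT element `χ`
of the Goeritz group `Stab(N 0) ∩ Stab(N 1)` of the standard genus-`3k` splitting of `#ᵏ S¹×S²`
carries `N 2 ⊔ N 0 ⊔ M` to `K 2 ⊔ N 0 ⊔ M` (seen from inside `H₀` and modulo the level, the third
kernel is standard).  This is the plan's Stub 1 (finitary Andrews–Curtis normal form in
`F = S ⧸ N 0`, Borovik–Lubotzky–Myasnikov 2005 / Myropolska 2013 Thm 1.2 on the tail tuple, plus
the reservoir lemma) followed by its Stub 2 (Goeritz realisation of `Stab_{Aut F}(π N 1)`), in the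
WEAKER merged form that the composition actually consumes (the card's recorded fallback (b): only the
level-`M` image of `N 1`-preserving automorphisms is needed, so the exact-realisation claim of Stub 2,
flagged as possibly false by its own card, is not asserted).  The genus-`3` case (`m = 0`) is NOT
part of this stub: it is the tree theorem `stub_faceNormalFormGenusThree` (exact, `M`-free), used
below.  Sandwiched: `UnstableStandard ⇒` this (`χ := α`, `oneSidedNormalForm_of_iso`).
WHY IT MIGHT FAIL: only at a balanced trisection of a homotopy 4-sphere not isomorphic to the standard
one; the proof route needs BLM + the unproved reservoir lemma + Luft/McCullough (none in Mathlib).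
Size XL. -/
theorem stub_oneSidedNormalForm_succ :
    ∀ (n : ℕ) (K : TrisectionKernels (3 + 3 * (n + 1))),
      IsGroupTrisection (3 + 3 * (n + 1)) (n + 1 + 1) (PUnit : Type) K →
      K 0 = s4Kernels.stabilizeIter (n + 1) 0 → K 1 = s4Kernels.stabilizeIter (n + 1) 1 →
      ∀ M : Subgroup (SurfaceGroup (3 + 3 * (n + 1))), M.Characteristic → M.FiniteIndex →
      ∃ χ : SurfaceGroup (3 + 3 * (n + 1)) ≃* SurfaceGroup (3 + 3 * (n + 1)),
        (s4Kernels.stabilizeIter (n + 1) 0).map χ.toMonoidHom = s4Kernels.stabilizeIter (n + 1) 0 ∧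
        (s4Kernels.stabilizeIter (n + 1) 1).map χ.toMonoidHom = s4Kernels.stabilizeIter (n + 1) 1 ∧
        (s4Kernels.stabilizeIter (n + 1) 2 ⊔ s4Kernels.stabilizeIter (n + 1) 0 ⊔ M).map
            χ.toMonoidHom =
          K 2 ⊔ s4Kernels.stabilizeIter (n + 1) 0 ⊔ M := by
  sorry

/-! ## 2–5. (LANDED) The four K-free / primitive stubs of the reshape

`stub_centralizerFreeKernel` (p112221), `stub_stdPairPrimitives` (p113423),
`stub_trisectionPairPrimitives_zero` (p114214), `stub_trisectionPairPrimitives_succ` (p114822) are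
tree theorems (`Theorems/CongruenceShadowsShadowsStandardStub*.lean`, namespace
`…Theorems.ShadowsStandard.FinitaryAcCentralResidue`).  They are consumed by the Theorems file
proving the two EFFECTIVE CENTRELESSNESS stubs below (§7a/§7b), so they no longer appear in this
skeleton; their statements are recorded in `Lines/finitary-ac-central-residue.lean` history
(skeleton sha fd8614a4) and on the item's stub registry. -/

/-! ## 6. INTERSECTION RIGIDITY (the residue crux C⁺, level-wise) — LOAD-BEARING (lead)

Stub 3 · `stub_intersectionRigidity` · for a slot-normalised trisection `(N 0, N 1, K 2)` of `{1}`
already in finitary-AC normal form at the characteristic finite-index level `M`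
(`K 2 ⊔ N 0 ⊔ M = N 2 ⊔ N 0 ⊔ M`), some EXACT Goeritz element `φ ∈ St₀ ∩ St₁` fixes
`N 2 ⊔ N 0 ⊔ M` and carries the standard double intersection `N₀M ∩ N₂M` to `N₀M ∩ K₂M`.
This is the card's Transfer in residue coordinates, with the coherent/profinite clause REMOVED
(the two-level residue lemma makes the level-wise form sufficient).  Sandwiched:
`UnstableStandard ⇒` Stub 3 (take `φ = α`, the isomorphism `N ≅ K`) and Stubs 1–4 `⇒` crux; not
implied by the crux (level stabilisers are bigger than `St₀ ∩ St₁` already at the abelian level,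
`GL_g(ℤ) → GL_g(𝔽_p)` not onto).  The object is ONE normal subgroup of the finite group `S/M`
inside `N₀M/M`: discretely `(N₀ ∩ K₂)/[N₀,K₂] ≅ π₂(H₀ ∪ H₂′) = π₂(#ᵏS¹×S²)` (Brown–Loday /
Gutiérrez–Ratcliffe), the module of REDUCING SPHERES of the `(0,2′)` splitting, on which the
Goeritz group of the STANDARD `(0,1)` splitting acts; at `m = 0` it is generated over `[N₀,N₂]` by
the common meridian `a₂` (triage r1-3 correction: `a₂`, not `a₁`, in the tree frame
`N = (⟪a₁,a₂,b₃⟫, ⟪a₁,b₂,a₃⟫, ⟪b₁,a₂,a₃⟫)`).  WHY IT MIGHT FAIL: it is stronger than the crux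
at each level (exact `St₀ ∩ St₁`): a non-standard balanced trisection of `S⁴` (MSZ Conj. 3.11,
"likely false") with standard shadows could violate it at deep levels; at `m = 0` it carries the
whole genus-3 content (Aranda–Zupan arXiv:2503.04607 Q 8.2/8.3).  Size: open-problem-sized at
`m = 0`; the line's bet is that it is the RIGHT residual (abelian-group-valued obstruction
`Hom_Q(B₂/D_M, Z(B₀/D_M))` per level, reducing-curve generators, relation-module layers). -/
theorem stub_intersectionRigidity :
    ∀ (m : ℕ) (K : TrisectionKernels (3 + 3 * m)),
      IsGroupTrisection (3 + 3 * m) (m + 1) (PUnit : Type) K →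
      K 0 = s4Kernels.stabilizeIter m 0 → K 1 = s4Kernels.stabilizeIter m 1 →
      ∀ M : Subgroup (SurfaceGroup (3 + 3 * m)), M.Characteristic → M.FiniteIndex →
      K 2 ⊔ s4Kernels.stabilizeIter m 0 ⊔ M =
        s4Kernels.stabilizeIter m 2 ⊔ s4Kernels.stabilizeIter m 0 ⊔ M →
      ∃ φ : SurfaceGroup (3 + 3 * m) ≃* SurfaceGroup (3 + 3 * m),
        (s4Kernels.stabilizeIter m 0).map φ.toMonoidHom = s4Kernels.stabilizeIter m 0 ∧
        (s4Kernels.stabilizeIter m 1).map φ.toMonoidHom = s4Kernels.stabilizeIter m 1 ∧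
        (s4Kernels.stabilizeIter m 2 ⊔ s4Kernels.stabilizeIter m 0 ⊔ M).map φ.toMonoidHom =
          s4Kernels.stabilizeIter m 2 ⊔ s4Kernels.stabilizeIter m 0 ⊔ M ∧
        ((s4Kernels.stabilizeIter m 0 ⊔ M) ⊓ (s4Kernels.stabilizeIter m 2 ⊔ M)).map φ.toMonoidHom =
          (s4Kernels.stabilizeIter m 0 ⊔ M) ⊓ (K 2 ⊔ M) := by
  sorry

/-! ## 6½. Sandwich certificates (sorry-free): the two `K`-dependent stubs follow from `N ≅ K`

If the slot-normalised triple `K` is isomorphic to the standard one (`UnstableStandard` of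
Disproof §1 restricted to slot-normalised triples — in AGK's dictionary SPC4 ∧ balanced 4-d
Waldhausen), then Stub 1 and Stub 3 hold for `K` with `θ = ᾱ`, `φ = α`.  So neither stub can be
refuted without exhibiting a balanced group trisection of `{1}` not isomorphic to the standard one
at its own genus (an exotic `S⁴` or a counterexample to MSZ Conj. 3.11); and the certificates
check that the two statements are not mis-typed. Stubs 2 and 4 do not mention `K`. -/

/-- **Sandwich for Stub 3.** -/
theorem intersectionRigidity_of_iso (m : ℕ) (K : TrisectionKernels (3 + 3 * m))
    (α : SurfaceGroup (3 + 3 * m) ≃* SurfaceGroup (3 + 3 * m))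
    (hα : ∀ i : Fin 3, (s4Kernels.stabilizeIter m i).map α.toMonoidHom = K i)
    (h0 : K 0 = s4Kernels.stabilizeIter m 0) (h1 : K 1 = s4Kernels.stabilizeIter m 1)
    (M : Subgroup (SurfaceGroup (3 + 3 * m))) (hM : M.Characteristic)
    (hsup : K 2 ⊔ s4Kernels.stabilizeIter m 0 ⊔ M =
      s4Kernels.stabilizeIter m 2 ⊔ s4Kernels.stabilizeIter m 0 ⊔ M) :
    ∃ φ : SurfaceGroup (3 + 3 * m) ≃* SurfaceGroup (3 + 3 * m),
      (s4Kernels.stabilizeIter m 0).map φ.toMonoidHom = s4Kernels.stabilizeIter m 0 ∧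
      (s4Kernels.stabilizeIter m 1).map φ.toMonoidHom = s4Kernels.stabilizeIter m 1 ∧
      (s4Kernels.stabilizeIter m 2 ⊔ s4Kernels.stabilizeIter m 0 ⊔ M).map φ.toMonoidHom =
        s4Kernels.stabilizeIter m 2 ⊔ s4Kernels.stabilizeIter m 0 ⊔ M ∧
      ((s4Kernels.stabilizeIter m 0 ⊔ M) ⊓ (s4Kernels.stabilizeIter m 2 ⊔ M)).map φ.toMonoidHom =
        (s4Kernels.stabilizeIter m 0 ⊔ M) ⊓ (K 2 ⊔ M) := by
  have hα0 : (s4Kernels.stabilizeIter m 0).map α.toMonoidHom = s4Kernels.stabilizeIter m 0 := by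
    rw [hα 0, h0]
  refine ⟨α, hα0, by rw [hα 1, h1], ?_, ?_⟩
  · rw [Subgroup.map_sup, Subgroup.map_sup, hα 2, hα0, map_char α hM, hsup]
  · rw [Subgroup.map_inf_eq _ _ _ α.injective, Subgroup.map_sup, Subgroup.map_sup, hα0, hα 2,
      map_char α hM]

/-- **Sandwich for the merged one-sided normal form.** -/
theorem oneSidedNormalForm_of_iso (m : ℕ) (K : TrisectionKernels (3 + 3 * m))
    (α : SurfaceGroup (3 + 3 * m) ≃* SurfaceGroup (3 + 3 * m))
    (hα : ∀ i : Fin 3, (s4Kernels.stabilizeIter m i).map α.toMonoidHom = K i)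
    (h0 : K 0 = s4Kernels.stabilizeIter m 0) (h1 : K 1 = s4Kernels.stabilizeIter m 1)
    (M : Subgroup (SurfaceGroup (3 + 3 * m))) (hM : M.Characteristic) :
    ∃ χ : SurfaceGroup (3 + 3 * m) ≃* SurfaceGroup (3 + 3 * m),
      (s4Kernels.stabilizeIter m 0).map χ.toMonoidHom = s4Kernels.stabilizeIter m 0 ∧
      (s4Kernels.stabilizeIter m 1).map χ.toMonoidHom = s4Kernels.stabilizeIter m 1 ∧
      (s4Kernels.stabilizeIter m 2 ⊔ s4Kernels.stabilizeIter m 0 ⊔ M).map χ.toMonoidHom =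
        K 2 ⊔ s4Kernels.stabilizeIter m 0 ⊔ M := by
  have hα0 : (s4Kernels.stabilizeIter m 0).map α.toMonoidHom = s4Kernels.stabilizeIter m 0 := by
    rw [hα 0, h0]
  refine ⟨α, hα0, by rw [hα 1, h1], ?_⟩
  rw [Subgroup.map_sup, Subgroup.map_sup, hα 2, hα0, map_char α hM]

/-! ## 7a. EFFECTIVE CENTRELESSNESS for the standard pair `(N 0, N 2)` (registered stub; PROVED in
`Theorems/CongruenceShadowsShadowsStandardEffectiveCentreless.lean` from §2 + §3)

Stub · `stub_effectiveCentrelessStd` · for every characteristic finite-index `M ≤ S_{3+3m}` there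
is a deeper characteristic finite-index `M' ≤ M` such that an element of `N 0` central in `N 0`
modulo `N 2 ⊔ M'` lies in `N 2 ⊔ M`.  (Plan Stub 4 for the standard pair; elementary: Magnus
quotient via `stub_centralizerFreeKernel` + explicit generators via `stub_stdPairPrimitives`; the
deeper level is `M ⊓ M_Q`, `M_Q` a verbal level.)  Size M (done). -/
theorem stub_effectiveCentrelessStd :
    ∀ (m : ℕ) (M : Subgroup (SurfaceGroup (3 + 3 * m))), M.Characteristic → M.FiniteIndex →
      ∃ M' : Subgroup (SurfaceGroup (3 + 3 * m)), M'.Characteristic ∧ M'.FiniteIndex ∧ M' ≤ M ∧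
        ∀ x ∈ s4Kernels.stabilizeIter m 0, (∀ y ∈ s4Kernels.stabilizeIter m 0,
          y * x * y⁻¹ * x⁻¹ ∈ s4Kernels.stabilizeIter m 2 ⊔ M') →
          x ∈ s4Kernels.stabilizeIter m 2 ⊔ M := by
  sorry

/-! ## 7b. EFFECTIVE CENTRELESSNESS for the trisection pair `(N 0, K 2)` (registered stub; PROVED in
`Theorems/CongruenceShadowsShadowsStandardEffectiveCentreless.lean` from §2 + §4 + §5)

Stub · `stub_effectiveCentrelessTrisection` · the same with `N 2` replaced by the third kernel `K 2`
of a slot-normalised `(3+3m; m+1)` group trisection of `{1}` (genus 3: face character + Euclid;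
genus ≥ 6: Nielsen normal form).  Size M (done). -/
theorem stub_effectiveCentrelessTrisection :
    ∀ (m : ℕ) (K : TrisectionKernels (3 + 3 * m)),
      IsGroupTrisection (3 + 3 * m) (m + 1) (PUnit : Type) K →
      K 0 = s4Kernels.stabilizeIter m 0 → K 1 = s4Kernels.stabilizeIter m 1 →
      ∀ M : Subgroup (SurfaceGroup (3 + 3 * m)), M.Characteristic → M.FiniteIndex →
      ∃ M' : Subgroup (SurfaceGroup (3 + 3 * m)), M'.Characteristic ∧ M'.FiniteIndex ∧ M' ≤ M ∧
        ∀ x ∈ s4Kernels.stabilizeIter m 0, (∀ y ∈ s4Kernels.stabilizeIter m 0,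
          y * x * y⁻¹ * x⁻¹ ∈ K 2 ⊔ M') → x ∈ K 2 ⊔ M := by
  sorry

/-! ## 8. THE RESIDUE REDUCTION (registered stub; pure glue, PROVED in
`Theorems/CongruenceShadowsShadowsStandardResidueReduction.lean`)

Stub · `stub_exactShadowReduction` · at genus `3+3m`: effective centrelessness (standard pair and
trisection pairs) ∧ one-sided normal form ∧ intersection rigidity, each at every characteristic
finite-index level ⟹ for every slot-normalised trisection `K` of `{1}` and every level `M` an
EXACT Goeritz element `ψ ∈ Stab(N 0) ∩ Stab(N 1)` with `ψ(N i ⊔ M) = K i ⊔ M` for all `i`.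
Proof (in the Theorems file): the deeper level `M' = M₁ ⊓ M₂` from the two effective-centrelessness
facts, the one-sided normal form `χ` at `M'`, intersection rigidity `φ` for `χ⁻¹ • K` at `M'`, the
two-level residue lemma in both directions (fed by effective centrelessness transported along `φ`
and `χ⁻¹`), and `ψ := χ ∘ φ`.  The same file proves the genus-3 corollaries
`rigid_genusThree_iff_exactShadow` (intersection rigidity ⟺ the normalised crux with exact
Goeritz stabilisers) and `shadowStandardAt_genusThree_of_rigid`.  Size S (done). -/
theorem stub_exactShadowReduction :
    ∀ (m : ℕ),
      (∀ (M : Subgroup (SurfaceGroup (3 + 3 * m))), M.Characteristic → M.FiniteIndex →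
        ∃ M' : Subgroup (SurfaceGroup (3 + 3 * m)), M'.Characteristic ∧ M'.FiniteIndex ∧ M' ≤ M ∧
          ∀ x ∈ s4Kernels.stabilizeIter m 0, (∀ y ∈ s4Kernels.stabilizeIter m 0,
            y * x * y⁻¹ * x⁻¹ ∈ s4Kernels.stabilizeIter m 2 ⊔ M') →
            x ∈ s4Kernels.stabilizeIter m 2 ⊔ M) →
      (∀ (K : TrisectionKernels (3 + 3 * m)),
        IsGroupTrisection (3 + 3 * m) (m + 1) (PUnit : Type) K →
        K 0 = s4Kernels.stabilizeIter m 0 → K 1 = s4Kernels.stabilizeIter m 1 →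
        ∀ M : Subgroup (SurfaceGroup (3 + 3 * m)), M.Characteristic → M.FiniteIndex →
        ∃ M' : Subgroup (SurfaceGroup (3 + 3 * m)), M'.Characteristic ∧ M'.FiniteIndex ∧ M' ≤ M ∧
          ∀ x ∈ s4Kernels.stabilizeIter m 0, (∀ y ∈ s4Kernels.stabilizeIter m 0,
            y * x * y⁻¹ * x⁻¹ ∈ K 2 ⊔ M') → x ∈ K 2 ⊔ M) →
      (∀ (K : TrisectionKernels (3 + 3 * m)),
        IsGroupTrisection (3 + 3 * m) (m + 1) (PUnit : Type) K →
        K 0 = s4Kernels.stabilizeIter m 0 → K 1 = s4Kernels.stabilizeIter m 1 →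
        ∀ M : Subgroup (SurfaceGroup (3 + 3 * m)), M.Characteristic → M.FiniteIndex →
        ∃ χ : SurfaceGroup (3 + 3 * m) ≃* SurfaceGroup (3 + 3 * m),
          (s4Kernels.stabilizeIter m 0).map χ.toMonoidHom = s4Kernels.stabilizeIter m 0 ∧
          (s4Kernels.stabilizeIter m 1).map χ.toMonoidHom = s4Kernels.stabilizeIter m 1 ∧
          (s4Kernels.stabilizeIter m 2 ⊔ s4Kernels.stabilizeIter m 0 ⊔ M).map χ.toMonoidHom =
            K 2 ⊔ s4Kernels.stabilizeIter m 0 ⊔ M) →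
      (∀ (K : TrisectionKernels (3 + 3 * m)),
        IsGroupTrisection (3 + 3 * m) (m + 1) (PUnit : Type) K →
        K 0 = s4Kernels.stabilizeIter m 0 → K 1 = s4Kernels.stabilizeIter m 1 →
        ∀ M : Subgroup (SurfaceGroup (3 + 3 * m)), M.Characteristic → M.FiniteIndex →
        K 2 ⊔ s4Kernels.stabilizeIter m 0 ⊔ M =
          s4Kernels.stabilizeIter m 2 ⊔ s4Kernels.stabilizeIter m 0 ⊔ M →
        ∃ φ : SurfaceGroup (3 + 3 * m) ≃* SurfaceGroup (3 + 3 * m),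
          (s4Kernels.stabilizeIter m 0).map φ.toMonoidHom = s4Kernels.stabilizeIter m 0 ∧
          (s4Kernels.stabilizeIter m 1).map φ.toMonoidHom = s4Kernels.stabilizeIter m 1 ∧
          (s4Kernels.stabilizeIter m 2 ⊔ s4Kernels.stabilizeIter m 0 ⊔ M).map φ.toMonoidHom =
            s4Kernels.stabilizeIter m 2 ⊔ s4Kernels.stabilizeIter m 0 ⊔ M ∧
          ((s4Kernels.stabilizeIter m 0 ⊔ M) ⊓ (s4Kernels.stabilizeIter m 2 ⊔ M)).map φ.toMonoidHom =
            (s4Kernels.stabilizeIter m 0 ⊔ M) ⊓ (K 2 ⊔ M)) →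
      ∀ (K : TrisectionKernels (3 + 3 * m)),
        IsGroupTrisection (3 + 3 * m) (m + 1) (PUnit : Type) K →
        K 0 = s4Kernels.stabilizeIter m 0 → K 1 = s4Kernels.stabilizeIter m 1 →
        ∀ M : Subgroup (SurfaceGroup (3 + 3 * m)), M.Characteristic → M.FiniteIndex →
        ∃ ψ : SurfaceGroup (3 + 3 * m) ≃* SurfaceGroup (3 + 3 * m),
          (s4Kernels.stabilizeIter m 0).map ψ.toMonoidHom = s4Kernels.stabilizeIter m 0 ∧
          (s4Kernels.stabilizeIter m 1).map ψ.toMonoidHom = s4Kernels.stabilizeIter m 1 ∧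
          ∀ i : Fin 3, (s4Kernels.stabilizeIter m i ⊔ M).map ψ.toMonoidHom = K i ⊔ M := by
  sorry

/-! ## 9. Composition (sorry-free glue) -/

/-- **The one-sided normal form at every genus**: genus `3` from the tree theorem
`stub_faceNormalFormGenusThree` (exact, hence at every level), genus `≥ 6` from the stub. -/
theorem oneSidedNormalForm (m : ℕ) (K : TrisectionKernels (3 + 3 * m))
    (hK : IsGroupTrisection (3 + 3 * m) (m + 1) (PUnit : Type) K)
    (h0 : K 0 = s4Kernels.stabilizeIter m 0) (h1 : K 1 = s4Kernels.stabilizeIter m 1)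
    (M : Subgroup (SurfaceGroup (3 + 3 * m))) (hM : M.Characteristic) (hMf : M.FiniteIndex) :
    ∃ χ : SurfaceGroup (3 + 3 * m) ≃* SurfaceGroup (3 + 3 * m),
      (s4Kernels.stabilizeIter m 0).map χ.toMonoidHom = s4Kernels.stabilizeIter m 0 ∧
      (s4Kernels.stabilizeIter m 1).map χ.toMonoidHom = s4Kernels.stabilizeIter m 1 ∧
      (s4Kernels.stabilizeIter m 2 ⊔ s4Kernels.stabilizeIter m 0 ⊔ M).map χ.toMonoidHom =
        K 2 ⊔ s4Kernels.stabilizeIter m 0 ⊔ M := by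
  cases m with
  | zero =>
    obtain ⟨χ, hχ0, hχ1, hχ2⟩ := stub_faceNormalFormGenusThree K hK h0 h1
    refine ⟨χ, hχ0, hχ1, ?_⟩
    change (s4Kernels 2 ⊔ s4Kernels 0 ⊔ M).map χ.toMonoidHom = K 2 ⊔ s4Kernels 0 ⊔ M
    rw [Subgroup.map_sup, hχ2, map_char χ hM]
  | succ n => exact stub_oneSidedNormalForm_succ n K hK h0 h1 M hM hMf

/-- **The crux on slot-normalised triples**, with an EXACT Goeritz standardiser: the reduction
stub applied to the two effective-centrelessness stubs, the one-sided normal form and intersection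
rigidity. -/
theorem normalised_case (m : ℕ) (K : TrisectionKernels (3 + 3 * m))
    (hK : IsGroupTrisection (3 + 3 * m) (m + 1) (PUnit : Type) K)
    (h0 : K 0 = s4Kernels.stabilizeIter m 0) (h1 : K 1 = s4Kernels.stabilizeIter m 1)
    (M : Subgroup (SurfaceGroup (3 + 3 * m))) (hM : M.Characteristic) (hMf : M.FiniteIndex) :
    ∃ ψ : SurfaceGroup (3 + 3 * m) ≃* SurfaceGroup (3 + 3 * m),
      (s4Kernels.stabilizeIter m 0).map ψ.toMonoidHom = s4Kernels.stabilizeIter m 0 ∧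
      (s4Kernels.stabilizeIter m 1).map ψ.toMonoidHom = s4Kernels.stabilizeIter m 1 ∧
      ∀ i : Fin 3, (s4Kernels.stabilizeIter m i ⊔ M).map ψ.toMonoidHom = K i ⊔ M :=
  stub_exactShadowReduction m (stub_effectiveCentrelessStd m) (stub_effectiveCentrelessTrisection m)
    (oneSidedNormalForm m) (stub_intersectionRigidity m) K hK h0 h1 M hM hMf

/-- **Composition.** The stubs prove the crux `CongruenceShadows.ShadowsStandard` BY NAME, given
the route's own item `WaldhausenPairs` (slot normalisation of the pair `(0,1)`): transport `K`
along the inverse of the Waldhausen automorphism `α`, apply `normalised_case`, undo `α`. -/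
theorem ShadowsStandard_of
    (hW : _root_.Summit.SmoothPoincare4.SmoothPoincare4.Theses.CongruenceShadows.WaldhausenPairs) :
    _root_.Summit.SmoothPoincare4.SmoothPoincare4.Theses.CongruenceShadows.ShadowsStandard := by
  intro m K hK M hM hMf
  obtain ⟨α, hα0, hα1⟩ := hW m K hK 0 1 (by decide)
  obtain ⟨ψ, -, -, hψ⟩ := normalised_case m (fun i => (K i).map α.symm.toMonoidHom)
    (isGroupTrisection_map hK α.symm) (map_symm_of_map α hα0) (map_symm_of_map α hα1) M hM hMf
  exact undo α hM ⟨ψ, hψ⟩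

end Summit.SmoothPoincare4.SmoothPoincare4.Cruxes.ShadowsStandard.FinitaryAcCentralResidue

end
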